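import Summits.CriticalPhenomena.Ising3DConformalLimit.Theses.FourToThreeSlab
import Literature.Probability.LatticeModels.IsingSlab
import HarnessLib

/-!
# Birth skeleton (BC3) for crux `SlabInfraredCompletion` — item stmt-CriticalPhenomena-4813

Route `FourToThreeSlab` (route-CriticalPhenomena-FourToThreeSlab), crux rank 2 ("S2, the IR problem"),
concluded BY NAME: `Summit.CriticalPhenomena.Ising3DConformalLimit.Theses.FourToThreeSlab.SlabInfraredCompletion`
— for all sufficiently large ring sizes `M`, the critical n.n. Ising model on the slab `ℤ³ × ℤ_M` (plus state
along `box 3 L ×ˢ ℤ_M`, `h = 0`, at its own `β_c(M)`), read on the layer `ℤ³ × {0}`, has a pointwise scaling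
limit in the exact sense of the conjunct: `∃ ρ > 0` on `(0,1]`, `Δ > 0`, `S` with `HasPointwiseScalingLimit`,
`IsNondegenerateTwoPoint`, `IsMoebiusCovariant Δ`, `HasNontrivialU4` (signature fixed by the route, never
restated here). The lattice family inlined in the crux is, letter for letter,
`Literature.Probability.LatticeModels.slabCriticalCorr 3 M` (`slabCriticalCorr_eq` is `rfl`, IsingSlab.lean —
the definition request of this very route, landed), so the stubs below are stated over that definition and the
composition bridges to the inlined term definitionally.

## The line: the route header's own TWO-LAYER PLAN for this node ("SlabInfraredCompletion ⇐
ThickSlabScaleCovariantLimit → ThickSlabMoebiusUpgrade"), typed as FOUR named stubs — the slab copy, one ring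
dimension up and fibred over `M`, of the proven decomposition of the conjunct by route `HyperoctahedralRP`
(items 1981 / 1980 / 1982 / 0636; its deciding theorem `closes` is the `M = 1` shadow of `SlabInfraredCompletion_of`)

  (crux) ⇐ [S1 thick slabs: a normalised, non-degenerate, translation-invariant, scale-covariant (Δ > 0)
               FULL pointwise scaling limit of `slabCriticalCorr 3 M` exists, eventually in M]      — constructive, OPEN
         + [S2 every such limit of a slab (any M ≥ 1) is O(3)-invariant]                               — port of LANDED ℤ³ proof
         + [S3 every such Euclidean limit of a slab (any M ≥ 1) is inversion covariant, same Δ]        — slab item 1982, OPEN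
         + [S4 thick slabs: every such Möbius-covariant limit is non-Gaussian, U₄ ≢ 0]                 — slab item 0636, OPEN

* `stub_thickSlabScaleCovariantLimit` (S1; the HARDEST stub, the crux's constructive heart = the slab analogue of
  item stmt-CriticalPhenomena-1981 `HyperoctahedralRP.ExistsScaleCovariantLimit`, asked only eventually in `M`):
  `∀ᶠ M, ∃ ρ Δ S`, `ρ > 0` on `(0,1]`, `0 < Δ`, `HasPointwiseScalingLimit (slabCriticalCorr 3 M) ρ S`, `S = 0`
  off `NonCoincident`, `IsNondegenerateTwoPoint S`, `IsTranslationInvariant S`, `IsScaleCovariant Δ S`.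
  Why plausibly true: for fixed `M` the slab is a 3D reflection-positive ferromagnet whose infrared limit is
  expected to be the Ising₃ fixed point; the route's thesis is that for THICK slabs the flow STARTS weakly coupled
  (`SlabGaussianWindow`, `u(M) ≍ 1/log M`, AizenmanDuminilCopinAnnals2021 transported) so that rigorous RG about
  the Gaussian point (GawedzkiKupiainenMasslessLattice1985, BrydgesMitterScoppola2003, Abdesselam2007) has an
  honest initial condition. By the ℤ³ disprover's analysis of item 1981 (Cruxes/ExistsScaleCovariantLimit/
  Disproof.lean §A: `iff_pure_existence`) normalisation, translation invariance, scale covariance and `Δ` are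
  FREE once a non-degenerate full-filter limit exists — the same is expected on the slab (lattice translations of
  `ℤ³ × ℤ_M` in the `ℤ³` directions; DCP-type power bounds); the open content is pure existence along the full
  mesh filter `𝓝[>] 0`. Why it might fail: only subsequential limits (a log-periodic modulation, Disproof §E
  `no_limit_of_hasDsiPair` shape), or `m*(β_c(M)) > 0` on the slab forcing `Δ = 0` (continuity à la
  AizenmanDuminilCopinSidoravicius2015 is printed for `ℤ^d`, not for slabs). Size: open problem.
* `stub_slabLimitRotationInvariant` (S2; L, PORT OF A LANDED PROOF): for every `M ≥ 1`, every limit as in S1 of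
  `slabCriticalCorr 3 M` is `O(3)`-invariant. The `ℤ³` statement is item stmt-CriticalPhenomena-1980
  `HyperoctahedralRP.LimitRotationInvariant`, PROVED (`Cruxes.LimitRotationInvariant.QuarterTurnLiouville.
  limitRotationInvariant_proof`, fed with the proved continuum rigidity `Cruxes.HRP2Rigidity.XRayMellin.HRP2Rigidity_of`,
  item 1979): hyperoctahedral symmetry + reflection positivity in the nine mirror families + scale covariance
  force isotropy of the limit. The slab `ℤ³ × ℤ_M` has the same nine `ℤ³`-direction mirror families (site and
  bond reflections commute with the ring), the same hyperoctahedral point group acting on the layer, GKS, and the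
  infrared / Simon–Lieb power bounds that pin `Δ ∈ [1/2, 1]` (RP Gaussian domination on the slab torus; sharpness
  on the transitive slab graph, DuminilCopinTassionCMP2016); `HRP2Rigidity` is purely continuum and reusable as is.
  Why it might fail: only if a slab-specific input of the port (RP of the slab plus state at `β_c(M)` through
  `ℤ³`-hyperplanes, or the two power bounds at `β_c(M)`) fails — none is expected to. [FrohlichSimonSpencer1976,
  Biskup2009RP, DuminilCopinTassionCMP2016, MessagerMiracleSole1977]
* `stub_slabInversionUpgrade` (S3; OPEN, XL): for every `M ≥ 1`, every normalised, non-degenerate,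
  EUCLIDEAN-invariant, scale-covariant limit of `slabCriticalCorr 3 M` is inversion covariant with the same `Δ` —
  the slab copy of item stmt-CriticalPhenomena-1982 `HyperoctahedralRP.InversionUpgradeNormalised` (open; shared
  by 12 routes; zero-slack lattice reformulations in Theorems/HyperoctahedralRPInversionUpgradeNormalisedConditional.lean).
  All six hypotheses of 1982 are kept, so the landed negative knowledge transfers verbatim: normalisation, the
  lattice-limit clause and scale covariance are LOAD-BEARING (Theorems/InversionUpgradeNormalised/Negative/
  LoadBearingHypotheses.lean: `not_cruxWithoutNormalisation`, `not_cruxWithoutIsingLimit`,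
  `not_cruxWithoutScaleCovariance`), the origin guard is built into `IsInversionCovariant` (`not_unguarded`).
  Why plausibly true: the infrared fixed point of every slab is the (conformal) Ising₃ point; why it might fail:
  scale + Euclidean covariance do not imply inversion covariance model-blindly
  (`Literature.Barriers.CriticalPhenomena.ScaleCovarianceNotMoebius`) — the slab-Ising provenance must be used.
  [DuminilCopinICM2022 §8.4, PolandRychkovVichi2019, DelamotteTissierWschebor2016]
* `stub_thickSlabNonGaussian` (S4; OPEN): eventually in `M`, every normalised, non-degenerate, MÖBIUS-covariant
  (`Δ > 0`) full scaling limit of `slabCriticalCorr 3 M` has `U₄ ≢ 0`. The slab copy — weakened by the extra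
  covariance hypotheses the composition can afford, and asked only for thick slabs — of item
  stmt-CriticalPhenomena-0636 `IsingEuclidUpgradeR4NonGaussian`. Why plausibly true: a Gaussian Möbius-covariant
  limit of a reflection-positive nearest-neighbour (Markov) model should be the free field, `Δ = 1/2`
  (Newman1975Gaussian; route AnomalousForcesInteraction's dichotomy `GaussianLimitIsFree` + `η > 0 ⇒ Δ > 1/2`),
  while the slab's `η` is the 3D one; in RG language the thick slab leaves the Gaussian point along its unstable
  manifold (Cardy1996 §4.5). Why it might fail: non-triviality in `d = 3` is open even at the level of Aizenman's
  intersection criterion (Aizenman1982; theorems in print go the other way: ADC2021 in `d = 4`, Panis2023 for RP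
  long-range models on `ℤ³`), and `η_slab > 0` is as open as `EtaPositive` (item 2600).

`SlabInfraredCompletion_of` takes EXACTLY the four stub statements and concludes the crux BY NAME (pure logic:
intersect the two eventual statements S1, S4 in `Filter.atTop`; at such an `M`, S1 gives `ρ, Δ, S` with the seven
clauses, S2 adds rotations, hence Euclidean invariance, S3 adds the inversion, whence `IsMoebiusCovariant Δ S`,
and S4 gives `HasNontrivialU4 S`; the inlined lattice family of the crux is `slabCriticalCorr 3 M` by `rfl`).
The only `sorry`s of the file sit inside the four `stub_*`.

Disproof / negatives: no `Disproof.lean` exists for this crux (`ledger crux ls stmt-CriticalPhenomena-4813`: no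
workfiles, 2026-08-17); `ledger negatives --problem CriticalPhenomena` (11 entries, 2026-08-17) has nothing in
this sub-problem — no slab, scaling-limit or covariance statement. Imported negative knowledge of the `ℤ³`
siblings honoured: 1982's load-bearing hypotheses (all kept in S2/S3), 1981's Disproof.lean (S1 keeps the full
filter `𝓝[>] 0` — the dyadic/subsequential weakening is where `no_limit_of_hasDsiPair` bites), the
coincident-configuration junk of Theorems/IsingEuclidUpgradeRefutations.lean (normalisation clause in S1–S4;
`HasNontrivialU4` and the crux itself are junk-insensitive / existential).
BC3 audit (2026-08-17; probe files kept in the registrar's folder `bc/`, table in `Lines/birth.md`): `lean check`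
rc 0, errors none, 4 `sorry` warnings = the 4 `stub_*` declarations, zero elsewhere; `#print axioms
SlabInfraredCompletion_of` = [propext, Classical.choice, Quot.sound]. For each stub Sᵢ the probes
`Sᵢ → SlabInfraredCompletion` and `Sᵢ → Ising3DConformalLimit` by `first | exact? | simpa | aesop` (and the
unfolding variants `simpa [T] | (unfold T; simpa)`, and `intro h; unfold T; first | exact? | simpa using h | aesop`,
400 000 heartbeats each) ALL FAIL: 24/24 examples (unsolved goals / `aesop` exhaustive-search failure / type
mismatch / `exact?` could not close the goal / whnf heartbeat time-out), plus 6/6 single-tactic examples for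
S1 → summit; the positive control (crux → crux, `∃ M₀ ∀ M ≥ M₀`-restated crux → crux, summit abbrev → Literature
conjecture) closes with the same battery, so the failures are informative. No stub is cheaply the crux or the summit.
Skeleton registrar: planner-skel-stmt-CriticalPhenomena-4813-0 (2026-08-17).
-/

noncomputable section

namespace Summit.CriticalPhenomena.Ising3DConformalLimit.Cruxes.SlabInfraredCompletion.Birth

open Literature.Probability.LatticeModels
open Filter
open Summit.CriticalPhenomena.Ising3DConformalLimit.Theses.FourToThreeSlab (SlabInfraredCompletion)

/-! ## Registered stubs (four statements, each spelled out; `SlabInfraredCompletion_of` takes exactly these) -/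

/-- **S1 — thick slabs have a normalised, non-degenerate, translation-invariant, scale-covariant full
pointwise scaling limit** (the constructive heart; OPEN, hardest): eventually in the ring size `M`, the
layer-`0` critical correlators `slabCriticalCorr 3 M` of `ℤ³ × ℤ_M` at `β_c(M)` admit `ρ > 0` on `(0,1]`,
`Δ > 0` and `S : CorrFamily 3` with `HasPointwiseScalingLimit (slabCriticalCorr 3 M) ρ S`, `S = 0` off
`NonCoincident`, `S₂ > 0` off the diagonal, translation invariance and scale covariance of weight `Δ`.
Slab analogue (eventually in `M`) of item stmt-CriticalPhenomena-1981. [DuminilCopinICM2022 §8.4;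
AizenmanDuminilCopinAnnals2021; GawedzkiKupiainenMasslessLattice1985; BrydgesMitterScoppola2003; Abdesselam2007] -/
theorem stub_thickSlabScaleCovariantLimit :
    ∀ᶠ M : ℕ in Filter.atTop, ∀ [NeZero M],
      ∃ (ρ : ℝ → ℝ) (Δ : ℝ) (S : CorrFamily 3),
        (∀ δ ∈ Set.Ioc (0:ℝ) 1, 0 < ρ δ) ∧ 0 < Δ ∧
        HasPointwiseScalingLimit (slabCriticalCorr 3 M) ρ S ∧
        (∀ n z, z ∉ NonCoincident 3 n → S n z = 0) ∧
        IsNondegenerateTwoPoint S ∧ IsTranslationInvariant S ∧ IsScaleCovariant Δ S := by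
  sorry

/-- **S2 — isotropy of slab scaling limits** (L; port of the LANDED `ℤ³` proof, items 1979 + 1980 of route
`HyperoctahedralRP`): for every ring size `M ≥ 1`, every normalised, non-degenerate, translation-invariant,
scale-covariant (`Δ > 0`) pointwise scaling limit of `slabCriticalCorr 3 M` (renormalisation `ρ > 0` on
`(0,1]`) is invariant under all linear isometries of `ℝ³`. [FrohlichSimonSpencer1976; Biskup2009RP;
DuminilCopinTassionCMP2016; tree: `limitRotationInvariant_proof`, `HRP2Rigidity_of`] -/
theorem stub_slabLimitRotationInvariant :
    ∀ (M : ℕ) [NeZero M] (ρ : ℝ → ℝ) (Δ : ℝ) (S : CorrFamily 3),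
      (∀ δ ∈ Set.Ioc (0:ℝ) 1, 0 < ρ δ) → 0 < Δ →
      HasPointwiseScalingLimit (slabCriticalCorr 3 M) ρ S →
      (∀ n z, z ∉ NonCoincident 3 n → S n z = 0) →
      IsNondegenerateTwoPoint S → IsTranslationInvariant S → IsScaleCovariant Δ S →
      IsRotationInvariant S := by
  sorry

/-- **S3 — inversion upgrade for slab scaling limits** (OPEN, XL; the slab copy of item
stmt-CriticalPhenomena-1982 `InversionUpgradeNormalised`, all six hypotheses kept): for every `M ≥ 1`, every
normalised, non-degenerate, Euclidean-invariant, scale-covariant (`Δ > 0`) pointwise scaling limit of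
`slabCriticalCorr 3 M` is covariant under the unit inversion with the same weight `Δ`. Model-blind version
false (`ScaleCovarianceNotMoebius`); the slab-Ising clause is load-bearing. [DuminilCopinICM2022 §8.1–8.4;
PolandRychkovVichi2019 §II; DelamotteTissierWschebor2016] -/
theorem stub_slabInversionUpgrade :
    ∀ (M : ℕ) [NeZero M] (ρ : ℝ → ℝ) (Δ : ℝ) (S : CorrFamily 3),
      (∀ δ ∈ Set.Ioc (0:ℝ) 1, 0 < ρ δ) → 0 < Δ →
      HasPointwiseScalingLimit (slabCriticalCorr 3 M) ρ S →
      (∀ n z, z ∉ NonCoincident 3 n → S n z = 0) →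
      IsNondegenerateTwoPoint S → IsEuclideanInvariant S → IsScaleCovariant Δ S →
      IsInversionCovariant Δ S := by
  sorry

/-- **S4 — thick critical slabs are non-Gaussian in the infrared** (OPEN; the slab copy, weakened by the
covariance hypotheses and asked only eventually in `M`, of item stmt-CriticalPhenomena-0636): eventually in
`M`, every normalised, non-degenerate, Möbius-covariant (`Δ > 0`) pointwise scaling limit `S` of
`slabCriticalCorr 3 M` has a not identically vanishing connected four-point function. [Aizenman1982;
Newman1975Gaussian; AizenmanDuminilCopinAnnals2021; Cardy1996 §4.5; Aizenman2021CDM §11] -/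
theorem stub_thickSlabNonGaussian :
    ∀ᶠ M : ℕ in Filter.atTop, ∀ [NeZero M], ∀ (ρ : ℝ → ℝ) (Δ : ℝ) (S : CorrFamily 3),
      (∀ δ ∈ Set.Ioc (0:ℝ) 1, 0 < ρ δ) → 0 < Δ →
      HasPointwiseScalingLimit (slabCriticalCorr 3 M) ρ S →
      (∀ n z, z ∉ NonCoincident 3 n → S n z = 0) →
      IsNondegenerateTwoPoint S → IsMoebiusCovariant Δ S →
      HasNontrivialU4 S := by
  sorry

/-! ## Composition (sorry-free): the four stub STATEMENTS imply the crux, by name -/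

/-- **COMPOSITION.** S1 → S2 → S3 → S4 → `SlabInfraredCompletion` (the FourToThreeSlab decl of item
stmt-CriticalPhenomena-4813). Intersect the eventual statements S1 and S4 in `Filter.atTop`; at such a ring
size `M`, S1 supplies `ρ, Δ, S` with limit, normalisation, non-degeneracy, translation invariance and scale
covariance; S2 adds `O(3)`-invariance (hence Euclidean invariance), S3 the inversion, so `IsMoebiusCovariant Δ S`;
S4 gives `HasNontrivialU4 S`. The crux's inlined lattice family is `slabCriticalCorr 3 M` definitionally
(`slabCriticalCorr_eq`, `rfl`). -/
theorem SlabInfraredCompletion_of :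
    (∀ᶠ M : ℕ in Filter.atTop, ∀ [NeZero M],
      ∃ (ρ : ℝ → ℝ) (Δ : ℝ) (S : CorrFamily 3),
        (∀ δ ∈ Set.Ioc (0:ℝ) 1, 0 < ρ δ) ∧ 0 < Δ ∧
        HasPointwiseScalingLimit (slabCriticalCorr 3 M) ρ S ∧
        (∀ n z, z ∉ NonCoincident 3 n → S n z = 0) ∧
        IsNondegenerateTwoPoint S ∧ IsTranslationInvariant S ∧ IsScaleCovariant Δ S) →
    (∀ (M : ℕ) [NeZero M] (ρ : ℝ → ℝ) (Δ : ℝ) (S : CorrFamily 3),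
      (∀ δ ∈ Set.Ioc (0:ℝ) 1, 0 < ρ δ) → 0 < Δ →
      HasPointwiseScalingLimit (slabCriticalCorr 3 M) ρ S →
      (∀ n z, z ∉ NonCoincident 3 n → S n z = 0) →
      IsNondegenerateTwoPoint S → IsTranslationInvariant S → IsScaleCovariant Δ S →
      IsRotationInvariant S) →
    (∀ (M : ℕ) [NeZero M] (ρ : ℝ → ℝ) (Δ : ℝ) (S : CorrFamily 3),
      (∀ δ ∈ Set.Ioc (0:ℝ) 1, 0 < ρ δ) → 0 < Δ →
      HasPointwiseScalingLimit (slabCriticalCorr 3 M) ρ S →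
      (∀ n z, z ∉ NonCoincident 3 n → S n z = 0) →
      IsNondegenerateTwoPoint S → IsEuclideanInvariant S → IsScaleCovariant Δ S →
      IsInversionCovariant Δ S) →
    (∀ᶠ M : ℕ in Filter.atTop, ∀ [NeZero M], ∀ (ρ : ℝ → ℝ) (Δ : ℝ) (S : CorrFamily 3),
      (∀ δ ∈ Set.Ioc (0:ℝ) 1, 0 < ρ δ) → 0 < Δ →
      HasPointwiseScalingLimit (slabCriticalCorr 3 M) ρ S →
      (∀ n z, z ∉ NonCoincident 3 n → S n z = 0) →
      IsNondegenerateTwoPoint S → IsMoebiusCovariant Δ S →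
      HasNontrivialU4 S) →
    SlabInfraredCompletion := by
  intro hLim hRot hInv hU4
  unfold SlabInfraredCompletion
  filter_upwards [hLim, hU4] with M hLimM hU4M
  intro inst
  obtain ⟨ρ, Δ, S, hρ, hΔ, hlim, hnorm, hnd, htr, hsc⟩ := hLimM
  have hrot : IsRotationInvariant S := hRot M ρ Δ S hρ hΔ hlim hnorm hnd htr hsc
  have heuc : IsEuclideanInvariant S := ⟨htr, hrot⟩
  have hinv : IsInversionCovariant Δ S := hInv M ρ Δ S hρ hΔ hlim hnorm hnd heuc hsc
  have hmoeb : IsMoebiusCovariant Δ S := ⟨heuc, hsc, hinv⟩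
  have hu4 : HasNontrivialU4 S := hU4M ρ Δ S hρ hΔ hlim hnorm hnd hmoeb
  exact ⟨ρ, Δ, S, hρ, hΔ, hlim, hnd, hmoeb, hu4⟩

/-- The crux from the four registered stubs (shows the stubs have exactly the hypothesis types of
`SlabInfraredCompletion_of`; its only `sorry`s are the stubs'). -/
theorem SlabInfraredCompletion_of_stubs : SlabInfraredCompletion :=
  SlabInfraredCompletion_of stub_thickSlabScaleCovariantLimit stub_slabLimitRotationInvariant
    stub_slabInversionUpgrade stub_thickSlabNonGaussian

end Summit.CriticalPhenomena.Ising3DConformalLimit.Cruxes.SlabInfraredCompletion.Birth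

end
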